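import Summits.CriticalPhenomena.SAWScalingLimit.Theorems.SAWDevelopingMapHexTransferGMHexDictionaryInverse

/-!
# The `π/3` dictionary, part III: the decoded walk and the bijection

Helper file of the line `yb-relay` for the crux `HexTransfer` (stmt-CriticalPhenomena-14221), stub
`stub_gmHexDictionary`, continuing `…GMHexDictionaryWalks`/`…Inverse`. For boundary edges `a ≠ b` of
a face set `Δ`:

* `hvAt g e` — the triangle of the rhombus `g` resting on its side `e` (the `HV` chart of `triAt`);
* **`decodeWalk`** — the Yang–Baxter walk `a :: pairEdges S ++ [b]` of a self-avoiding honeycomb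
  path `S` from the triangle resting on `a` to the one resting on `b` through triangles of rhombi of
  `Δ`, with `hvInner_decodeWalk : hvInner = S`, `weight_decodeWalk : w_{π/3} = x_c ^ |S|`;
* **`head?_hvInner`, `getLast?_hvInner`, `decodeWalk_hvInner`** — conversely the triangle list of a
  walk of nonzero weight is such a path and decodes back to the walk: the dictionary is a bijection
  between the walks of nonzero weight from `a` to `b` and the honeycomb paths;
* `reachable_fc` — the rhombi of a walk from `a` lie in the face component of `a`.

[cite: GlazmanManolescu2019, §1 p. 3, Fig. 2]; elementary statements tagged [folklore].
-/

namespace Summit.CriticalPhenomena.SAWScalingLimit.Cruxes.HexTransfer.YbRelay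

open Literature.Probability.RandomPlanarGeometry
open Literature.Probability.RandomPlanarGeometry.SAW
open Literature.Probability.RandomPlanarGeometry.SAW.YangBaxter

/-! ### Honeycomb paths between boundary triangles -/

/-- The triangle of the rhombus `g` resting on the mid-edge `e` (a side of `g`), in the chart
`Face.hv` (the `HV` picture of `triAt`). [folklore] -/
def hvAt (g : Face) (e : MidEdge) : HV :=
  if e = g.side .W ∨ e = g.side .N then g.hv .W else g.hv .S

/-- `hvAt g (g.side s)` is the triangle of the side `s`. [folklore] -/
theorem hvAt_side (g : Face) (s : Side) : hvAt g (g.side s) = g.hv s := by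
  have hinj := Face.side_injective g
  unfold hvAt
  cases s
  · rw [if_pos (Or.inl rfl)]
  · rw [if_neg (by rintro (h | h) <;> exact absurd (hinj h) (by decide))]
    exact Face.hv_eq_hv_iff.2 ⟨rfl, rfl⟩
  · rw [if_neg (by rintro (h | h) <;> exact absurd (hinj h) (by decide))]
  · rw [if_pos (Or.inr rfl)]
    exact Face.hv_eq_hv_iff.2 ⟨rfl, rfl⟩

/-- `hvAt g e` is the triangle of the side `s` when `e = g.side s`. [folklore] -/
theorem hvAt_eq_of_side {g : Face} {s : Side} {e : MidEdge} (h : g.side s = e) : hvAt g e = g.hv s := by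
  subst h; exact hvAt_side g s

section Decode

variable {Δ : Set Face} {a b : MidEdge} (ha : IsBdryEdge Δ a) (hb : IsBdryEdge Δ b) (hab : a ≠ b)
  {S : List HV} (h₁ : S.IsChain hvGraph.Adj) (h₂ : S.Nodup) (h₃ : S.head? = some (hvAt (inclFace Δ a) a))
  (h₄ : S.getLast? = some (hvAt (inclFace Δ b) b)) (h₅ : ∀ v ∈ S, faceHV v ∈ Δ)
include ha hb hab h₁ h₂ h₃ h₄ h₅

/-- **Decoding a path.** For a self-avoiding honeycomb path `S` (a chain of the coordinate honeycomb
without repetition) from the triangle of `Δ` resting on the boundary edge `a` to the one resting on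
the boundary edge `b ≠ a`, through triangles of rhombi of `Δ`, the mid-edge list
`a :: pairEdges S ++ [b]` has all its arcs in rhombi of `Δ`, consecutive arcs in different rhombi,
and triangle list `S`. [cite: GlazmanManolescu2019, §1 p. 3, Fig. 2] -/
theorem listTris_decode_path :
    listTris (a :: (YBWalk.pairEdges S ++ [b])) = S ∧
      (∀ p ∈ arcsOf (a :: (YBWalk.pairEdges S ++ [b])), ∃ g ∈ Δ, arcFace p = some g) ∧
      (arcsOf (a :: (YBWalk.pairEdges S ++ [b]))).IsChain (fun p q => arcFace p ≠ arcFace q) := by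
  obtain ⟨hgaΔ, sa, hsa⟩ := ha.inclFace_spec
  obtain ⟨hgbΔ, sb, hsb⟩ := hb.inclFace_spec
  obtain ⟨t, R, rfl⟩ := List.exists_cons_of_ne_nil (show S ≠ [] by rintro rfl; simp at h₃)
  have ht : t = (inclFace Δ a).hv sa := by
    rw [List.head?_cons, Option.some.injEq] at h₃
    rw [h₃, hvAt_eq_of_side hsa]
  have key := listTris_decode hb R (inclFace Δ a) sa t h₁ h₂ (by rw [ht, faceHV_hv])
    (fun g s' hg hne hmem => hne (ha.eq_inclFace (hg.trans hsa) (by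
      have h := h₅ (g.hv s') (List.mem_cons_of_mem _ hmem)
      rwa [faceHV_hv] at h)))
    (fun h => absurd (by rw [ht]; rfl) h)
    ⟨inclFace Δ b, sb, hsb, by
      apply Option.some_injective
      rw [← List.getLast?_eq_some_getLast, h₄, hvAt_eq_of_side hsb]⟩
    (by rw [hsa]; exact hab.symm) h₅
  rw [hsa, if_pos (by rw [ht]; rfl), List.nil_append] at key
  exact ⟨key.1, key.2.1, key.2.2.1⟩

/-- **The Yang–Baxter walk of a honeycomb path** `S` between boundary edges `a ≠ b` of `Δ` (a
self-avoiding chain from the triangle resting on `a` to the one resting on `b` through triangles of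
rhombi of `Δ`): it crosses `a`, the sides crossed by the path, and `b`.
[cite: GlazmanManolescu2019, §1 p. 3, Fig. 2] -/
def decodeWalk : YBWalk Δ a b where
  mids := a :: (YBWalk.pairEdges S ++ [b])
  head_eq := rfl
  getLast_eq := by rw [← List.cons_append, List.getLast?_append]; rfl
  nodup := by
    rw [List.nodup_cons, List.mem_append, List.mem_singleton, not_or]
    refine ⟨⟨ha.not_mem_pairEdges h₅, hab⟩, List.Nodup.append (nodup_pairEdges S h₂)
      (List.nodup_singleton b) fun e he he' => ?_⟩
    rw [List.mem_singleton] at he'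
    subst he'
    exact hb.not_mem_pairEdges h₅ he
  arc_mem := (listTris_decode_path ha hb hab h₁ h₂ h₃ h₄ h₅).2.1
  isChain := (listTris_decode_path ha hb hab h₁ h₂ h₃ h₄ h₅).2.2
  noncross := noncross_of_nodup_listTris (by rw [(listTris_decode_path ha hb hab h₁ h₂ h₃ h₄ h₅).1]; exact h₂)

/-- The mid-edges of the decoded walk. [folklore] -/
@[simp] theorem decodeWalk_mids :
    (decodeWalk ha hb hab h₁ h₂ h₃ h₄ h₅).mids = a :: (YBWalk.pairEdges S ++ [b]) := rfl

/-- **The triangle list of the decoded walk is the path.** [cite: GlazmanManolescu2019, §1 p. 3, Fig. 2] -/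
theorem hvInner_decodeWalk : (decodeWalk ha hb hab h₁ h₂ h₃ h₄ h₅).hvInner = S := by
  rw [YBWalk.hvInner_eq_listTris]
  exact (listTris_decode_path ha hb hab h₁ h₂ h₃ h₄ h₅).1

/-- **The weight of the decoded walk is `x_c` to the number of triangles** (in particular nonzero).
[cite: GlazmanManolescu2019, §1 p. 3 ("with weight (1/√(2+√2))^{|γ|}")] -/
theorem weight_decodeWalk :
    (decodeWalk ha hb hab h₁ h₂ h₃ h₄ h₅).weight (fun _ => Real.pi / 3) = hexCriticalFugacity ^ S.length := by
  have hnd : (decodeWalk ha hb hab h₁ h₂ h₃ h₄ h₅).hvInner.Nodup := by rw [hvInner_decodeWalk]; exact h₂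
  rcases YBWalk.weight_hex_eq (decodeWalk ha hb hab h₁ h₂ h₃ h₄ h₅) with h | h
  · rw [h, hvInner_decodeWalk]
  · exact absurd h (YBWalk.weight_ne_zero_of_nodup_hvInner _ hnd)

end Decode

/-! ### The triangle list of a walk of nonzero weight is a path, decoding back to the walk -/

/-- Across any side of a rhombus lies another rhombus. [folklore] -/
theorem exists_across (f : Face) (s : Side) : ∃ (g : Face) (s' : Side), g.side s' = f.side s ∧ g ≠ f := by
  obtain ⟨k, j⟩ := f
  cases s
  · exact ⟨(k - 1, j), .E, by simp [Face.side], by simp⟩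
  · exact ⟨(k + 1, j), .W, by simp [Face.side], by simp⟩
  · exact ⟨(k, j - 1), .N, by simp [Face.side], by simp⟩
  · exact ⟨(k, j + 1), .S, by simp [Face.side], by simp⟩

section Encode

variable {Δ : Set Face} {a b : MidEdge}

/-- The first arc of a walk from the boundary edge `a` lies in `inclFace Δ a`, entering through `a`.
[folklore] -/
theorem fc_zero_eq (ha : IsBdryEdge Δ a) (hab : a ≠ b) (γ : YBWalk Δ a b) :
    γ.fc 0 = inclFace Δ a ∧ (γ.fc 0).side (γ.sIn 0) = a := by
  have h0 := YBWalk.arcs_length_pos γ hab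
  have hs := (YBWalk.side_sIn h0).1
  simp only [γ.getElem_zero] at hs
  exact ⟨ha.eq_inclFace hs (YBWalk.arcFace_arcAt h0).2, hs⟩

/-- The last arc of a walk to the boundary edge `b` lies in `inclFace Δ b`, leaving through `b`.
[folklore] -/
theorem fc_last_eq (hb : IsBdryEdge Δ b) (hab : a ≠ b) (γ : YBWalk Δ a b) :
    γ.fc (γ.arcs.length - 1) = inclFace Δ b ∧
      (γ.fc (γ.arcs.length - 1)).side (γ.sOut (γ.arcs.length - 1)) = b := by
  have h0 := YBWalk.arcs_length_pos γ hab
  have hs := (YBWalk.side_sIn (γ := γ) (i := γ.arcs.length - 1) (by omega)).2.1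
  have hidx : γ.arcs.length - 1 + 1 = γ.mids.length - 1 := by have := γ.length_arcs; omega
  simp only [hidx, γ.getElem_length_sub_one] at hs
  exact ⟨hb.eq_inclFace hs (YBWalk.arcFace_arcAt (by omega)).2, hs⟩

/-- **The rhombi of a walk from `a` lie in the face component of `a`**: consecutive arcs lie in
side-adjacent rhombi of `Δ`. [folklore] -/
theorem reachable_fc (ha : IsBdryEdge Δ a) (γ : YBWalk Δ a b) {k : ℕ} (hk : k < γ.arcs.length) :
    (faceAdj Δ).Reachable (inclFace Δ a) (γ.fc k) := by
  induction k with
  | zero =>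
    have hab' : a ≠ b := YBWalk.a_ne_z hk
    rw [(fc_zero_eq ha hab' γ).1]
  | succ k ih =>
    refine (ih (by omega)).trans (SimpleGraph.Adj.reachable ?_)
    rw [faceAdj, SimpleGraph.fromRel_adj]
    refine ⟨YBWalk.fc_succ_ne hk, Or.inl ⟨⟨_, ⟨γ.sOut k, rfl⟩, γ.sIn (k + 1), ?_⟩,
      (YBWalk.arcFace_arcAt (by omega)).2, (YBWalk.arcFace_arcAt hk).2⟩⟩
    rw [(YBWalk.side_sIn hk).1, (YBWalk.side_sIn (show k < γ.arcs.length by omega)).2.1]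

/-- The rhombus of every triangle crossed by a walk from `a` lies in the face component of `a`.
[folklore] -/
theorem reachable_faceHV_of_mem_hvInner (ha : IsBdryEdge Δ a) (γ : YBWalk Δ a b) {v : HV} (hv : v ∈ γ.hvInner) :
    faceHV v ∈ Δ ∧ (faceAdj Δ).Reachable (inclFace Δ a) (faceHV v) := by
  obtain ⟨k, hk, s, rfl⟩ := YBWalk.exists_fc_of_mem_hvUpTo hv
  rw [faceHV_hv]
  exact ⟨(YBWalk.arcFace_arcAt hk).2, reachable_fc ha γ hk⟩

/-- **The triangle list of a walk between boundary edges starts on the triangle resting on `a`.**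
[cite: GlazmanManolescu2019, §1 p. 3, Fig. 2] -/
theorem head?_hvInner (ha : IsBdryEdge Δ a) (hab : a ≠ b) (γ : YBWalk Δ a b) :
    γ.hvInner.head? = some (hvAt (inclFace Δ a) a) := by
  obtain ⟨h1, h2⟩ := fc_zero_eq ha hab γ
  rw [YBWalk.hvInner, YBWalk.head?_hvUpTo (YBWalk.arcs_length_pos γ hab), ← h1, hvAt_eq_of_side h2]

/-- The triangle list of a walk between boundary edges ends on the triangle resting on `b`.
[cite: GlazmanManolescu2019, §1 p. 3, Fig. 2] -/
theorem getLast?_hvInner (hb : IsBdryEdge Δ b) (hab : a ≠ b) (γ : YBWalk Δ a b) :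
    γ.hvInner.getLast? = some (hvAt (inclFace Δ b) b) := by
  obtain ⟨h1, h2⟩ := fc_last_eq hb hab γ
  have h0 := YBWalk.arcs_length_pos γ hab
  rw [YBWalk.hvInner, show γ.arcs.length = γ.arcs.length - 1 + 1 by omega, YBWalk.getLast?_hvUpTo_succ,
    ← h1, hvAt_eq_of_side h2]

/-- **Encoding then decoding gives the walk back** (for a walk whose triangle list is self-avoiding,
i.e. of nonzero weight): the crossed mid-edges are read off the triangle list
(`pairEdges_cons_hvUpTo`). [cite: GlazmanManolescu2019, §1 p. 3, Fig. 2] -/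
theorem decodeWalk_hvInner (ha : IsBdryEdge Δ a) (hb : IsBdryEdge Δ b) (hab : a ≠ b) (γ : YBWalk Δ a b)
    (hnd : γ.hvInner.Nodup) :
    decodeWalk ha hb hab (YBWalk.isChain_hvUpTo le_rfl) hnd (head?_hvInner ha hab γ) (getLast?_hvInner hb hab γ)
      (fun _ hv => (reachable_faceHV_of_mem_hvInner ha γ hv).1) = γ := by
  apply YBWalk.ext
  rw [decodeWalk_mids]
  have h0 := YBWalk.arcs_length_pos γ hab
  obtain ⟨g, s', hgs, hg⟩ := exists_across (γ.fc 0) (γ.sIn 0)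
  have hstart : 0 < γ.arcs.length → edgeOf (g.hv s') ((γ.fc 0).hv (γ.sIn 0)) = some a := fun _ => by
    rw [edgeOf_of_side_eq hgs hg, hgs, (fc_zero_eq ha hab γ).2]
  have key := YBWalk.pairEdges_cons_hvUpTo (g.hv s') hstart le_rfl
  obtain ⟨t, R, htR⟩ := List.exists_cons_of_ne_nil (YBWalk.hvUpTo_ne_nil (γ := γ) (i := γ.arcs.length) h0)
  have hhead : t = (γ.fc 0).hv (γ.sIn 0) := by
    have := YBWalk.head?_hvUpTo (γ := γ) (i := γ.arcs.length) h0
    rw [htR] at this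
    simpa using this
  change a :: (YBWalk.pairEdges (γ.hvUpTo γ.arcs.length) ++ [b]) = γ.mids
  rw [htR] at key ⊢
  rw [pairEdges_cons_cons, hhead, hstart h0, ← hhead] at key
  change a :: YBWalk.pairEdges (t :: R) = _ at key
  have hlen := γ.length_arcs
  have hb' := γ.getElem_length_sub_one
  simp only [show γ.mids.length - 1 = γ.arcs.length by omega] at hb'
  rw [← List.cons_append, key, show List.take γ.arcs.length γ.mids ++ [b] =
      List.take γ.arcs.length γ.mids ++ [γ.mids[γ.arcs.length]] by rw [hb'],
    ← List.take_succ_eq_append_getElem, List.take_of_length_le]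
  omega

end Encode

/-- **Main statement of this file (registered sub-goal of `stub_gmHexDictionary`)**: a Yang–Baxter walk of
nonzero weight between boundary edges is the decoding of its (self-avoiding) triangle list.
[cite: GlazmanManolescu2019, §1 p. 3, Fig. 2] -/
theorem decodeWalk_hvInner_eq_self : ∀ {Δ : Set Face} {a b : MidEdge} (ha : IsBdryEdge Δ a) (hb : IsBdryEdge Δ b) (hab : a ≠ b) (γ : YBWalk Δ a b) (hnd : γ.hvInner.Nodup), decodeWalk ha hb hab (YBWalk.isChain_hvUpTo le_rfl) hnd (head?_hvInner ha hab γ) (getLast?_hvInner hb hab γ) (fun _ hv => (reachable_faceHV_of_mem_hvInner ha γ hv).1) = γ := by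
  intro Δ a b ha hb hab γ hnd
  exact decodeWalk_hvInner ha hb hab γ hnd

end Summit.CriticalPhenomena.SAWScalingLimit.Cruxes.HexTransfer.YbRelay
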